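import Summits.QuantumAdvantage.QuantumAdvantage.Theorems.CubicForrelationNearExactIsExactTwelveLevelSixDeltaZeroTransversal
import Summits.QuantumAdvantage.QuantumAdvantage.Theorems.CubicForrelationNearExactIsExactTwelveLevelFiveR1RadicalAt2932

/-!
# Crux `CubicForrelation.NearExactIsExact` (stmt-QuantumAdvantage-14043) — n = 12 AT `Φ = 29/32`, level-6 configuration (δ₀): the `−3σ`-set `T` is a
  COSET OF THE RADICAL of the relative form, `#rad = 32`

Certificate seat `b2b-cforr-cert` (gen 23).  HONEST FRAMING: finite-slice lemmas (standard axioms; the two closed Boolean identities `r1_pf_rank2`,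
`r1_gram_kernel` of the level-5 file are reused) about cubic Boolean pairs on 12 bits; the level-6 analogue of `…TwelveLevelFiveR1RadicalAt2932` with
the base-`x_Z` relative form `B` of `fr_hsd` (bi-additive by `fr_B_add_left`).  NOT summit progress.

1. (`d0_diff_radical`) `T ⊕ T ⊆ R = rad B ∩ V₀` (else a quadruple `(δ, v, c', d')` with `Pf = 1` has a 4-flat through `t` meeting `T` twice,
   against `d0_transversal`; the rank-2 Pfaffian identity `r1_pf_rank2`).
2. (`d0_R_bound`) `16·#R ≤ #V₀ = 512` (injectivity of `(r,θ) ↦ r ⊕ θ·a` on `R × 𝔽₂⁴`, Gram kernel `r1_gram_kernel`).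
3. (`d0_structure`) `#R = 32` and `T = t₀ ⊕ R`.

References: MacWilliams–Sloane (1977) Ch. 15 §2; Carlet (2020) §5.2.  Axioms: the standard three.
-/

set_option linter.dupNamespace false -- D-0017: single-problem summit ⇒ `QuantumAdvantage.QuantumAdvantage` by design

noncomputable section

namespace Summit.QuantumAdvantage.QuantumAdvantage.Theorems.CubicForrelation.NearExactIsExact

open Finset
open Literature.Computability.QuantumComplexity
open Literature.Computability.QuantumComplexity.BuzetChailloux (bxor zeroVec bxor_bxor_cancel_left bxor_zeroVec zeroVec_bxor bxor_comm
  bxor_self)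
open Literature.Computability.QuantumComplexity.DerivativeWalsh (W)

/-! ### 1. The relative form on flat points of the origin -/

/-- `B(0, w) = 0` (base-`x_Z` form). [folklore] -/
theorem d0_B_zero_left (hb : (Fin (6 + 6) → Bool) → Bool) (xZ w : Fin (6 + 6) → Bool) :
    (hb xZ ^^ hb (bxor xZ zeroVec) ^^ hb (bxor xZ w) ^^ hb (bxor (bxor xZ zeroVec) w)) = false := by
  rw [bxor_zeroVec]; cases hb xZ <;> cases hb (bxor xZ w) <;> rfl

/-- `B(p·a, w) = p ∧ B(a, w)` (base-`x_Z` form). [folklore] -/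
theorem d0_B_smul_left (hb : (Fin (6 + 6) → Bool) → Bool) (xZ : Fin (6 + 6) → Bool) (p : Bool) (a w : Fin (6 + 6) → Bool) :
    (hb xZ ^^ hb (bxor xZ (fun j => p && a j)) ^^ hb (bxor xZ w) ^^ hb (bxor (bxor xZ (fun j => p && a j)) w)) = (p && (hb xZ ^^ hb (bxor xZ a) ^^ hb (bxor xZ w) ^^ hb (bxor (bxor xZ a) w))) := by
  cases p
  · have h : (fun j => false && a j) = (zeroVec : Fin (6 + 6) → Bool) := funext fun j => by simp [zeroVec]
    rw [h, Bool.false_and]; exact d0_B_zero_left hb xZ w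
  · have h : (fun j => true && a j) = a := funext fun j => by simp
    rw [h, Bool.true_and]

/-- **`B` at a flat point of the origin** (base-`x_Z` form, bi-additivity `fr_B_add_left` along `V₀`). [folklore] -/
theorem d0_B_flatPt (V₀ : Finset (Fin (6 + 6) → Bool)) (u'' : (Fin (6 + 6) → Bool) → ℤ) (xZ : Fin (6 + 6) → Bool) (h0 : zeroVec ∈ V₀)
    (hadd : ∀ a ∈ V₀, ∀ b ∈ V₀, bxor a b ∈ V₀) (hS : (univ.filter fun x : Fin (6 + 6) → Bool => ¬ Odd (u'' x)) = V₀.image (bxor xZ)) (hb : (Fin (6 + 6) → Bool) → Bool)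
    (hsd : ∀ x, x ∈ (univ.filter fun x : Fin (6 + 6) → Bool => ¬ Odd (u'' x)) → ∀ p ∈ V₀, ∀ q ∈ V₀, hb (bxor (bxor x p) q) =
      (hb x ^^ hb (bxor x p) ^^ hb (bxor x q) ^^ (hb xZ ^^ hb (bxor xZ p) ^^ hb (bxor xZ q) ^^ hb (bxor (bxor xZ p) q))))
    (a₀ a₁ a₂ a₃ : Fin (6 + 6) → Bool) (ha₀ : a₀ ∈ V₀) (ha₁ : a₁ ∈ V₀) (ha₂ : a₂ ∈ V₀) (ha₃ : a₃ ∈ V₀)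
    (θ : Fin 4 → Bool) (w : Fin (6 + 6) → Bool) (hw : w ∈ V₀) :
    (hb xZ ^^ hb (bxor xZ (fun j => zeroVec j ^^ decide (Odd #(univ.filter fun i => θ i && (![a₀, a₁, a₂, a₃] : Fin 4 → Fin (6 + 6) → Bool) i j)))) ^^ hb (bxor xZ w) ^^ hb (bxor (bxor xZ (fun j => zeroVec j ^^ decide (Odd #(univ.filter fun i => θ i && (![a₀, a₁, a₂, a₃] : Fin 4 → Fin (6 + 6) → Bool) i j)))) w)) =
      ((θ 0 && (hb xZ ^^ hb (bxor xZ a₀) ^^ hb (bxor xZ w) ^^ hb (bxor (bxor xZ a₀) w))) ^^ (θ 1 && (hb xZ ^^ hb (bxor xZ a₁) ^^ hb (bxor xZ w) ^^ hb (bxor (bxor xZ a₁) w))) ^^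
        (θ 2 && (hb xZ ^^ hb (bxor xZ a₂) ^^ hb (bxor xZ w) ^^ hb (bxor (bxor xZ a₂) w))) ^^ (θ 3 && (hb xZ ^^ hb (bxor xZ a₃) ^^ hb (bxor xZ w) ^^ hb (bxor (bxor xZ a₃) w)))) := by
  have hxZ : xZ ∈ (univ.filter fun x : Fin (6 + 6) → Bool => ¬ Odd (u'' x)) := by rw [hS]; exact mem_image.2 ⟨zeroVec, h0, bxor_zeroVec xZ⟩
  have hPV : ∀ x, x ∈ (univ.filter fun x : Fin (6 + 6) → Bool => ¬ Odd (u'' x)) → ∀ a ∈ V₀, bxor x a ∈ (univ.filter fun x : Fin (6 + 6) → Bool => ¬ Odd (u'' x)) := fun x hx a ha => fl1_coset_vadd hadd hS hx ha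
  have ec : (fun j => zeroVec j ^^ decide (Odd #(univ.filter fun i => θ i && (![a₀, a₁, a₂, a₃] : Fin 4 → Fin (6 + 6) → Bool) i j))) =
      bxor (bxor (bxor (bxor zeroVec (fun j => θ 0 && a₀ j)) (fun j => θ 1 && a₁ j)) (fun j => θ 2 && a₂ j))
        (fun j => θ 3 && a₃ j) := by
    rw [es_flatPt_four zeroVec _ θ]
    have e0 : (![a₀, a₁, a₂, a₃] : Fin 4 → Fin (6 + 6) → Bool) 0 = a₀ := rfl
    have e1 : (![a₀, a₁, a₂, a₃] : Fin 4 → Fin (6 + 6) → Bool) 1 = a₁ := rfl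
    have e2 : (![a₀, a₁, a₂, a₃] : Fin 4 → Fin (6 + 6) → Bool) 2 = a₂ := rfl
    have e3 : (![a₀, a₁, a₂, a₃] : Fin 4 → Fin (6 + 6) → Bool) 3 = a₃ := rfl
    simp only [e0, e1, e2, e3]
    exact es_flatPt_bxor zeroVec a₀ a₁ a₂ a₃ θ
  have m0 : (fun j => θ 0 && a₀ j) ∈ V₀ := fr_smul_mem V₀ h0 ha₀ (θ 0)
  have m1 : (fun j => θ 1 && a₁ j) ∈ V₀ := fr_smul_mem V₀ h0 ha₁ (θ 1)
  have m2 : (fun j => θ 2 && a₂ j) ∈ V₀ := fr_smul_mem V₀ h0 ha₂ (θ 2)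
  have m3 : (fun j => θ 3 && a₃ j) ∈ V₀ := fr_smul_mem V₀ h0 ha₃ (θ 3)
  have p0 : bxor zeroVec (fun j => θ 0 && a₀ j) ∈ V₀ := hadd _ h0 _ m0
  have p1 : bxor (bxor zeroVec (fun j => θ 0 && a₀ j)) (fun j => θ 1 && a₁ j) ∈ V₀ := hadd _ p0 _ m1
  have p2 : bxor (bxor (bxor zeroVec (fun j => θ 0 && a₀ j)) (fun j => θ 1 && a₁ j)) (fun j => θ 2 && a₂ j) ∈ V₀ := hadd _ p1 _ m2
  rw [ec, fr_B_add_left V₀ (· ∈ (univ.filter fun x : Fin (6 + 6) → Bool => ¬ Odd (u'' x))) xZ hb hxZ hPV hsd p2 m3 hw, fr_B_add_left V₀ (· ∈ (univ.filter fun x : Fin (6 + 6) → Bool => ¬ Odd (u'' x))) xZ hb hxZ hPV hsd p1 m2 hw,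
    fr_B_add_left V₀ (· ∈ (univ.filter fun x : Fin (6 + 6) → Bool => ¬ Odd (u'' x))) xZ hb hxZ hPV hsd p0 m1 hw, fr_B_add_left V₀ (· ∈ (univ.filter fun x : Fin (6 + 6) → Bool => ¬ Odd (u'' x))) xZ hb hxZ hPV hsd h0 m0 hw,
    d0_B_zero_left, d0_B_smul_left, d0_B_smul_left, d0_B_smul_left, d0_B_smul_left, Bool.false_xor]

/-! ### 2. `T ⊕ T ⊆ R` -/

/-- **Differences of `T` lie in the radical** (level-6 version). [this work] -/
theorem d0_diff_radical (f g : (Fin (6 + 6) → Bool) → Bool) (hf : IsDegLeFun 3 f) (hg : IsDegLeFun 3 g)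
    (u'' : (Fin (6 + 6) → Bool) → ℤ) (hu'' : ∀ x, W (fun y => signOf (g y)) x = (2 : ℝ) ^ 6 * (u'' x : ℝ))
    (V₀ : Finset (Fin (6 + 6) → Bool)) (xZ : Fin (6 + 6) → Bool) (h0 : zeroVec ∈ V₀) (hadd : ∀ a ∈ V₀, ∀ b ∈ V₀, bxor a b ∈ V₀)
    (hcardV : #V₀ = 512) (hS : (univ.filter fun x : Fin (6 + 6) → Bool => ¬ Odd (u'' x)) = V₀.image (bxor xZ))
    (hoff0 : ∀ y, y ∉ (univ.filter fun x : Fin (6 + 6) → Bool => ¬ Odd (u'' x)) → (u'' y - sZ (f y)) = 0)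
    (hb : (Fin (6 + 6) → Bool) → Bool)
    (hvals : ∀ x ∈ (univ.filter fun x : Fin (6 + 6) → Bool => ¬ Odd (u'' x)), (u'' x - sZ (f x)) = sZ (hb x) ∨ (u'' x - sZ (f x)) = -3 * sZ (hb x))
    (hT : #((univ.filter fun x : Fin (6 + 6) → Bool => ¬ Odd (u'' x)).filter fun x => (u'' x - sZ (f x)) = -3 * sZ (hb x)) = 32)
    {a₀ a₁ a₂ a₃ : Fin (6 + 6) → Bool} (ha₀ : a₀ ∈ V₀) (ha₁ : a₁ ∈ V₀) (ha₂ : a₂ ∈ V₀) (ha₃ : a₃ ∈ V₀)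
    (hPf : ((((hb xZ ^^ hb (bxor xZ a₁) ^^ hb (bxor xZ a₀) ^^ hb (bxor (bxor xZ a₁) a₀)) && (hb xZ ^^ hb (bxor xZ a₃) ^^ hb (bxor xZ a₂) ^^ hb (bxor (bxor xZ a₃) a₂))) ^^ ((hb xZ ^^ hb (bxor xZ a₂) ^^ hb (bxor xZ a₀) ^^ hb (bxor (bxor xZ a₂) a₀)) && (hb xZ ^^ hb (bxor xZ a₃) ^^ hb (bxor xZ a₁) ^^ hb (bxor (bxor xZ a₃) a₁))) ^^ ((hb xZ ^^ hb (bxor xZ a₃) ^^ hb (bxor xZ a₀) ^^ hb (bxor (bxor xZ a₃) a₀)) && (hb xZ ^^ hb (bxor xZ a₂) ^^ hb (bxor xZ a₁) ^^ hb (bxor (bxor xZ a₂) a₁))))) = true)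
    (t t' : Fin (6 + 6) → Bool) (ht : t ∈ (univ.filter fun x : Fin (6 + 6) → Bool => ¬ Odd (u'' x)) ∧ (u'' t - sZ (f t)) = -3 * sZ (hb t))
    (ht' : t' ∈ (univ.filter fun x : Fin (6 + 6) → Bool => ¬ Odd (u'' x)) ∧ (u'' t' - sZ (f t')) = -3 * sZ (hb t')) :
    bxor t t' ∈ (V₀.filter fun r => ∀ v ∈ V₀, (hb xZ ^^ hb (bxor xZ r) ^^ hb (bxor xZ v) ^^ hb (bxor (bxor xZ r) v)) = false) := by
  classical
  -- `δ = t ⊕ t'` is a period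
  have hδV : bxor t t' ∈ V₀ := by
    have h1 := ht.1; have h2 := ht'.1
    rw [hS] at h1 h2
    obtain ⟨w, hw, hwt⟩ := mem_image.1 h1
    obtain ⟨w', hw', hwt'⟩ := mem_image.1 h2
    have : bxor t t' = bxor w w' := by
      rw [← hwt, ← hwt']; funext j; simp only [bxor]; cases xZ j <;> cases w j <;> cases w' j <;> rfl
    rw [this]; exact hadd w hw w' hw'
  rw [mem_filter]
  refine ⟨hδV, fun v hv => ?_⟩
  rcases Bool.eq_false_or_eq_true (hb xZ ^^ hb (bxor xZ (bxor t t')) ^^ hb (bxor xZ v) ^^ hb (bxor (bxor xZ (bxor t t')) v)) with hB' | hB'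
  swap
  · exact hB'
  exfalso
  have hB : (hb xZ ^^ hb (bxor xZ v) ^^ hb (bxor xZ (bxor t t')) ^^ hb (bxor (bxor xZ v) (bxor t t'))) = true := by
    rw [← fr_B_symm xZ hb (bxor t t') v]; exact hB'
  have hex : ∃ c' ∈ V₀, ∃ d' ∈ V₀,
      ((((hb xZ ^^ hb (bxor xZ v) ^^ hb (bxor xZ (bxor t t')) ^^ hb (bxor (bxor xZ v) (bxor t t'))) && (hb xZ ^^ hb (bxor xZ d') ^^ hb (bxor xZ c') ^^ hb (bxor (bxor xZ d') c'))) ^^ ((hb xZ ^^ hb (bxor xZ c') ^^ hb (bxor xZ (bxor t t')) ^^ hb (bxor (bxor xZ c') (bxor t t'))) && (hb xZ ^^ hb (bxor xZ d') ^^ hb (bxor xZ v) ^^ hb (bxor (bxor xZ d') v))) ^^ ((hb xZ ^^ hb (bxor xZ d') ^^ hb (bxor xZ (bxor t t')) ^^ hb (bxor (bxor xZ d') (bxor t t'))) && (hb xZ ^^ hb (bxor xZ c') ^^ hb (bxor xZ v) ^^ hb (bxor (bxor xZ c') v))))) = true := by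
    by_contra hno
    push Not at hno
    have h01 := hno a₀ ha₀ a₁ ha₁
    have h23 := hno a₂ ha₂ a₃ ha₃
    have h02 := hno a₀ ha₀ a₂ ha₂
    have h13 := hno a₁ ha₁ a₃ ha₃
    have h03 := hno a₀ ha₀ a₃ ha₃
    have h12 := hno a₁ ha₁ a₂ ha₂
    rw [hB] at h01 h23 h02 h13 h03 h12
    generalize hp0 : (hb xZ ^^ hb (bxor xZ a₀) ^^ hb (bxor xZ (bxor t t')) ^^ hb (bxor (bxor xZ a₀) (bxor t t'))) = p₀ at h01 h02 h03
    generalize hp1 : (hb xZ ^^ hb (bxor xZ a₁) ^^ hb (bxor xZ (bxor t t')) ^^ hb (bxor (bxor xZ a₁) (bxor t t'))) = p₁ at h01 h12 h13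
    generalize hp2 : (hb xZ ^^ hb (bxor xZ a₂) ^^ hb (bxor xZ (bxor t t')) ^^ hb (bxor (bxor xZ a₂) (bxor t t'))) = p₂ at h23 h02 h12
    generalize hp3 : (hb xZ ^^ hb (bxor xZ a₃) ^^ hb (bxor xZ (bxor t t')) ^^ hb (bxor (bxor xZ a₃) (bxor t t'))) = p₃ at h23 h13 h03
    generalize hq0 : (hb xZ ^^ hb (bxor xZ a₀) ^^ hb (bxor xZ v) ^^ hb (bxor (bxor xZ a₀) v)) = q₀ at h01 h02 h03
    generalize hq1 : (hb xZ ^^ hb (bxor xZ a₁) ^^ hb (bxor xZ v) ^^ hb (bxor (bxor xZ a₁) v)) = q₁ at h01 h12 h13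
    generalize hq2 : (hb xZ ^^ hb (bxor xZ a₂) ^^ hb (bxor xZ v) ^^ hb (bxor (bxor xZ a₂) v)) = q₂ at h23 h02 h12
    generalize hq3 : (hb xZ ^^ hb (bxor xZ a₃) ^^ hb (bxor xZ v) ^^ hb (bxor (bxor xZ a₃) v)) = q₃ at h23 h13 h03
    generalize hg10 : (hb xZ ^^ hb (bxor xZ a₁) ^^ hb (bxor xZ a₀) ^^ hb (bxor (bxor xZ a₁) a₀)) = g10 at h01 hPf
    generalize hg32 : (hb xZ ^^ hb (bxor xZ a₃) ^^ hb (bxor xZ a₂) ^^ hb (bxor (bxor xZ a₃) a₂)) = g32 at h23 hPf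
    generalize hg20 : (hb xZ ^^ hb (bxor xZ a₂) ^^ hb (bxor xZ a₀) ^^ hb (bxor (bxor xZ a₂) a₀)) = g20 at h02 hPf
    generalize hg31 : (hb xZ ^^ hb (bxor xZ a₃) ^^ hb (bxor xZ a₁) ^^ hb (bxor (bxor xZ a₃) a₁)) = g31 at h13 hPf
    generalize hg30 : (hb xZ ^^ hb (bxor xZ a₃) ^^ hb (bxor xZ a₀) ^^ hb (bxor (bxor xZ a₃) a₀)) = g30 at h03 hPf
    generalize hg21 : (hb xZ ^^ hb (bxor xZ a₂) ^^ hb (bxor xZ a₁) ^^ hb (bxor (bxor xZ a₂) a₁)) = g21 at h12 hPf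
    have e10 : g10 = ((p₀ && q₁) ^^ (p₁ && q₀)) := by
      revert h01; cases g10 <;> cases p₀ <;> cases q₁ <;> cases p₁ <;> cases q₀ <;> decide
    have e32 : g32 = ((p₂ && q₃) ^^ (p₃ && q₂)) := by
      revert h23; cases g32 <;> cases p₂ <;> cases q₃ <;> cases p₃ <;> cases q₂ <;> decide
    have e20 : g20 = ((p₀ && q₂) ^^ (p₂ && q₀)) := by
      revert h02; cases g20 <;> cases p₀ <;> cases q₂ <;> cases p₂ <;> cases q₀ <;> decide
    have e31 : g31 = ((p₁ && q₃) ^^ (p₃ && q₁)) := by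
      revert h13; cases g31 <;> cases p₁ <;> cases q₃ <;> cases p₃ <;> cases q₁ <;> decide
    have e30 : g30 = ((p₀ && q₃) ^^ (p₃ && q₀)) := by
      revert h03; cases g30 <;> cases p₀ <;> cases q₃ <;> cases p₃ <;> cases q₀ <;> decide
    have e21 : g21 = ((p₁ && q₂) ^^ (p₂ && q₁)) := by
      revert h12; cases g21 <;> cases p₁ <;> cases q₂ <;> cases p₂ <;> cases q₁ <;> decide
    rw [e10, e32, e20, e31, e30, e21, r1_pf_rank2] at hPf
    exact Bool.false_ne_true hPf
  obtain ⟨c', hc', d', hd', hPf'⟩ := hex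
  have hN := d0_transversal f g hf hg u'' hu'' V₀ xZ h0 hadd hcardV hS hoff0 hb hvals hT hδV hv hc' hd' hPf' t ht.1
  have h2 : 1 < #(univ.filter fun ε : Fin 4 → Bool =>
      (u'' (fun j => t j ^^ decide (Odd #(univ.filter fun i => ε i && (![bxor t t', v, c', d'] : Fin 4 → Fin (6 + 6) → Bool) i j))) - sZ (f (fun j => t j ^^ decide (Odd #(univ.filter fun i => ε i && (![bxor t t', v, c', d'] : Fin 4 → Fin (6 + 6) → Bool) i j))))) = -3 * sZ (hb (fun j => t j ^^ decide (Odd #(univ.filter fun i => ε i && (![bxor t t', v, c', d'] : Fin 4 → Fin (6 + 6) → Bool) i j))))) := by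
    refine one_lt_card.2 ⟨fun _ => false, ?_, fun l => decide (l = 0), ?_, ?_⟩
    · rw [mem_filter]
      refine ⟨mem_univ _, ?_⟩
      rw [ffl_flatPt_zero t (![bxor t t', v, c', d'] : Fin 4 → Fin (6 + 6) → Bool)]
      exact ht.2
    · rw [mem_filter]
      refine ⟨mem_univ _, ?_⟩
      rw [ffl_flatPt_single t (![bxor t t', v, c', d'] : Fin 4 → Fin (6 + 6) → Bool) 0]
      have e0 : bxor t ((![bxor t t', v, c', d'] : Fin 4 → Fin (6 + 6) → Bool) 0) = t' := by
        show bxor t (bxor t t') = t'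
        rw [bxor_bxor_cancel_left]
      rw [e0]
      exact ht'.2
    · intro h
      have := congrFun h 0
      simp at this
  omega

/-! ### 3. `16·#R ≤ #V₀` -/

/-- **The radical has index `≥ 16` in `V₀`** when a frame with `Pf = 1` exists (level-6, base-`x_Z` version). [this work] -/
theorem d0_R_bound (V₀ : Finset (Fin (6 + 6) → Bool)) (u'' : (Fin (6 + 6) → Bool) → ℤ) (xZ : Fin (6 + 6) → Bool) (h0 : zeroVec ∈ V₀)
    (hadd : ∀ a ∈ V₀, ∀ b ∈ V₀, bxor a b ∈ V₀) (hS : (univ.filter fun x : Fin (6 + 6) → Bool => ¬ Odd (u'' x)) = V₀.image (bxor xZ)) (hb : (Fin (6 + 6) → Bool) → Bool)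
    (hsd : ∀ x, x ∈ (univ.filter fun x : Fin (6 + 6) → Bool => ¬ Odd (u'' x)) → ∀ p ∈ V₀, ∀ q ∈ V₀, hb (bxor (bxor x p) q) =
      (hb x ^^ hb (bxor x p) ^^ hb (bxor x q) ^^ (hb xZ ^^ hb (bxor xZ p) ^^ hb (bxor xZ q) ^^ hb (bxor (bxor xZ p) q))))
    {a₀ a₁ a₂ a₃ : Fin (6 + 6) → Bool} (ha₀ : a₀ ∈ V₀) (ha₁ : a₁ ∈ V₀) (ha₂ : a₂ ∈ V₀) (ha₃ : a₃ ∈ V₀)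
    (hPf : ((((hb xZ ^^ hb (bxor xZ a₁) ^^ hb (bxor xZ a₀) ^^ hb (bxor (bxor xZ a₁) a₀)) && (hb xZ ^^ hb (bxor xZ a₃) ^^ hb (bxor xZ a₂) ^^ hb (bxor (bxor xZ a₃) a₂))) ^^ ((hb xZ ^^ hb (bxor xZ a₂) ^^ hb (bxor xZ a₀) ^^ hb (bxor (bxor xZ a₂) a₀)) && (hb xZ ^^ hb (bxor xZ a₃) ^^ hb (bxor xZ a₁) ^^ hb (bxor (bxor xZ a₃) a₁))) ^^ ((hb xZ ^^ hb (bxor xZ a₃) ^^ hb (bxor xZ a₀) ^^ hb (bxor (bxor xZ a₃) a₀)) && (hb xZ ^^ hb (bxor xZ a₂) ^^ hb (bxor xZ a₁) ^^ hb (bxor (bxor xZ a₂) a₁))))) = true) :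
    16 * #(V₀.filter fun r => ∀ v ∈ V₀, (hb xZ ^^ hb (bxor xZ r) ^^ hb (bxor xZ v) ^^ hb (bxor (bxor xZ r) v)) = false) ≤ #V₀ := by
  classical
  have hxZ : xZ ∈ (univ.filter fun x : Fin (6 + 6) → Bool => ¬ Odd (u'' x)) := by rw [hS]; exact mem_image.2 ⟨zeroVec, h0, bxor_zeroVec xZ⟩
  have hPV : ∀ x, x ∈ (univ.filter fun x : Fin (6 + 6) → Bool => ¬ Odd (u'' x)) → ∀ a ∈ V₀, bxor x a ∈ (univ.filter fun x : Fin (6 + 6) → Bool => ¬ Odd (u'' x)) := fun x hx a ha => fl1_coset_vadd hadd hS hx ha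
  set R := (V₀.filter fun r => ∀ v ∈ V₀, (hb xZ ^^ hb (bxor xZ r) ^^ hb (bxor xZ v) ^^ hb (bxor (bxor xZ r) v)) = false) with hR
  have ha : ∀ i, (![a₀, a₁, a₂, a₃] : Fin 4 → Fin (6 + 6) → Bool) i ∈ V₀ := by
    intro i; fin_cases i <;> assumption
  set c : (Fin 4 → Bool) → (Fin (6 + 6) → Bool) := fun θ => (fun j => zeroVec j ^^ decide (Odd #(univ.filter fun i => θ i && (![a₀, a₁, a₂, a₃] : Fin 4 → Fin (6 + 6) → Bool) i j))) with hc
  have hcV : ∀ θ : Fin 4 → Bool, c θ ∈ V₀ := fun θ =>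
    ws_flatPt_mem V₀ h0 (fun z => z ∈ V₀) (fun z hz b hb' => hadd z hz b hb') 4 zeroVec h0 _ ha θ
  have hRV : ∀ r ∈ R, r ∈ V₀ := fun r hr => (mem_filter.1 hr).1
  have hcadd : ∀ θ θ' : Fin 4 → Bool, c (bxor θ θ') = bxor (c θ) (c θ') := by
    intro θ θ'
    funext j
    have hip := ffl_ip_bxor θ θ' (fun i => (![a₀, a₁, a₂, a₃] : Fin 4 → Fin (6 + 6) → Bool) i j)
    simp only [c, bxor]
    rw [hip]
    simp only [zeroVec, Bool.false_xor]
  have hinj : Set.InjOn (fun p : (Fin (6 + 6) → Bool) × (Fin 4 → Bool) => bxor p.1 (c p.2))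
      ↑(R ×ˢ (univ : Finset (Fin 4 → Bool))) := by
    rintro ⟨r, θ⟩ hr ⟨r', θ'⟩ hr' heq
    rw [mem_coe, mem_product] at hr hr'
    dsimp only at heq
    have hrr : bxor (c θ) (c θ') = bxor r r' := by
      funext j
      have h := congrFun heq j
      simp only [bxor] at h ⊢
      revert h
      cases r j <;> cases r' j <;> cases c θ j <;> cases c θ' j <;> decide
    have hmem : c (bxor θ θ') ∈ R := by
      rw [hcadd, hrr]; exact fr_radical_add V₀ (· ∈ (univ.filter fun x : Fin (6 + 6) → Bool => ¬ Odd (u'' x))) xZ hb hxZ hPV hadd hsd _ hr.1 _ hr'.1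
    have hm : ∀ w ∈ V₀, (hb xZ ^^ hb (bxor xZ (c (bxor θ θ'))) ^^ hb (bxor xZ w) ^^ hb (bxor (bxor xZ (c (bxor θ θ'))) w)) = false := (mem_filter.1 hmem).2
    have g0 := hm a₀ ha₀
    have g1 := hm a₁ ha₁
    have g2 := hm a₂ ha₂
    have g3 := hm a₃ ha₃
    simp only [c] at g0 g1 g2 g3
    rw [d0_B_flatPt V₀ u'' xZ h0 hadd hS hb hsd a₀ a₁ a₂ a₃ ha₀ ha₁ ha₂ ha₃ _ a₀ ha₀] at g0
    rw [d0_B_flatPt V₀ u'' xZ h0 hadd hS hb hsd a₀ a₁ a₂ a₃ ha₀ ha₁ ha₂ ha₃ _ a₁ ha₁] at g1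
    rw [d0_B_flatPt V₀ u'' xZ h0 hadd hS hb hsd a₀ a₁ a₂ a₃ ha₀ ha₁ ha₂ ha₃ _ a₂ ha₂] at g2
    rw [d0_B_flatPt V₀ u'' xZ h0 hadd hS hb hsd a₀ a₁ a₂ a₃ ha₀ ha₁ ha₂ ha₃ _ a₃ ha₃] at g3
    rw [fr_B_self xZ hb a₀] at g0
    rw [fr_B_symm xZ hb a₀ a₁, fr_B_self xZ hb a₁] at g1
    rw [fr_B_symm xZ hb a₀ a₂, fr_B_symm xZ hb a₁ a₂, fr_B_self xZ hb a₂] at g2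
    rw [fr_B_symm xZ hb a₀ a₃, fr_B_symm xZ hb a₁ a₃, fr_B_symm xZ hb a₂ a₃, fr_B_self xZ hb a₃] at g3
    have hθ := r1_gram_kernel _ _ _ _ _ _ (bxor θ θ' 0) (bxor θ θ' 1) (bxor θ θ' 2) (bxor θ θ' 3) hPf g0 g1 g2 g3
    have hθθ : θ = θ' := by
      funext i
      have hi : bxor θ θ' i = false := by
        fin_cases i
        exacts [hθ.1, hθ.2.1, hθ.2.2.1, hθ.2.2.2]
      simp only [bxor] at hi
      revert hi; cases θ i <;> cases θ' i <;> decide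
    subst hθθ
    have hrr' : r = r' := by
      funext j
      have h := congrFun heq j
      simp only [bxor] at h
      revert h; cases r j <;> cases r' j <;> cases c θ j <;> decide
    rw [hrr']
  have hmaps : ∀ p ∈ R ×ˢ (univ : Finset (Fin 4 → Bool)),
      (fun p : (Fin (6 + 6) → Bool) × (Fin 4 → Bool) => bxor p.1 (c p.2)) p ∈ V₀ := by
    rintro ⟨r, θ⟩ hp
    rw [mem_product] at hp
    exact hadd r (hRV r hp.1) _ (hcV θ)
  have hle := card_le_card_of_injOn _ hmaps hinj
  rw [card_product, card_univ, Fintype.card_fun, Fintype.card_bool, Fintype.card_fin] at hle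
  norm_num at hle
  omega

/-! ### 4. `T = t₀ ⊕ R` and `#R = 32` -/

/-- **Structure of the `−3σ`-set** (level-6 version): `#R = 32` and `T = t₀ ⊕ R` for every `t₀ ∈ T`. [this work] -/
theorem d0_structure (f g : (Fin (6 + 6) → Bool) → Bool) (hf : IsDegLeFun 3 f) (hg : IsDegLeFun 3 g)
    (u'' : (Fin (6 + 6) → Bool) → ℤ) (hu'' : ∀ x, W (fun y => signOf (g y)) x = (2 : ℝ) ^ 6 * (u'' x : ℝ))
    (V₀ : Finset (Fin (6 + 6) → Bool)) (xZ : Fin (6 + 6) → Bool) (h0 : zeroVec ∈ V₀) (hadd : ∀ a ∈ V₀, ∀ b ∈ V₀, bxor a b ∈ V₀)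
    (hcardV : #V₀ = 512) (hS : (univ.filter fun x : Fin (6 + 6) → Bool => ¬ Odd (u'' x)) = V₀.image (bxor xZ))
    (hoff0 : ∀ y, y ∉ (univ.filter fun x : Fin (6 + 6) → Bool => ¬ Odd (u'' x)) → (u'' y - sZ (f y)) = 0)
    (hb : (Fin (6 + 6) → Bool) → Bool)
    (hvals : ∀ x ∈ (univ.filter fun x : Fin (6 + 6) → Bool => ¬ Odd (u'' x)), (u'' x - sZ (f x)) = sZ (hb x) ∨ (u'' x - sZ (f x)) = -3 * sZ (hb x))
    (hT : #((univ.filter fun x : Fin (6 + 6) → Bool => ¬ Odd (u'' x)).filter fun x => (u'' x - sZ (f x)) = -3 * sZ (hb x)) = 32)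
    {a₀ a₁ a₂ a₃ : Fin (6 + 6) → Bool} (ha₀ : a₀ ∈ V₀) (ha₁ : a₁ ∈ V₀) (ha₂ : a₂ ∈ V₀) (ha₃ : a₃ ∈ V₀)
    (hPf : ((((hb xZ ^^ hb (bxor xZ a₁) ^^ hb (bxor xZ a₀) ^^ hb (bxor (bxor xZ a₁) a₀)) && (hb xZ ^^ hb (bxor xZ a₃) ^^ hb (bxor xZ a₂) ^^ hb (bxor (bxor xZ a₃) a₂))) ^^ ((hb xZ ^^ hb (bxor xZ a₂) ^^ hb (bxor xZ a₀) ^^ hb (bxor (bxor xZ a₂) a₀)) && (hb xZ ^^ hb (bxor xZ a₃) ^^ hb (bxor xZ a₁) ^^ hb (bxor (bxor xZ a₃) a₁))) ^^ ((hb xZ ^^ hb (bxor xZ a₃) ^^ hb (bxor xZ a₀) ^^ hb (bxor (bxor xZ a₃) a₀)) && (hb xZ ^^ hb (bxor xZ a₂) ^^ hb (bxor xZ a₁) ^^ hb (bxor (bxor xZ a₂) a₁))))) = true)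
    (t₀ : Fin (6 + 6) → Bool) (ht₀ : t₀ ∈ (univ.filter fun x : Fin (6 + 6) → Bool => ¬ Odd (u'' x)) ∧ (u'' t₀ - sZ (f t₀)) = -3 * sZ (hb t₀)) :
    #(V₀.filter fun r => ∀ v ∈ V₀, (hb xZ ^^ hb (bxor xZ r) ^^ hb (bxor xZ v) ^^ hb (bxor (bxor xZ r) v)) = false) = 32 ∧
      ((univ.filter fun x : Fin (6 + 6) → Bool => ¬ Odd (u'' x)).filter fun x => (u'' x - sZ (f x)) = -3 * sZ (hb x)) = (V₀.filter fun r => ∀ v ∈ V₀, (hb xZ ^^ hb (bxor xZ r) ^^ hb (bxor xZ v) ^^ hb (bxor (bxor xZ r) v)) = false).image (bxor t₀) := by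
  classical
  set R := (V₀.filter fun r => ∀ v ∈ V₀, (hb xZ ^^ hb (bxor xZ r) ^^ hb (bxor xZ v) ^^ hb (bxor (bxor xZ r) v)) = false) with hR
  have hsub : ((univ.filter fun x : Fin (6 + 6) → Bool => ¬ Odd (u'' x)).filter fun x => (u'' x - sZ (f x)) = -3 * sZ (hb x)) ⊆ R.image (bxor t₀) := by
    intro t ht
    rw [mem_filter] at ht
    have hr := d0_diff_radical f g hf hg u'' hu'' V₀ xZ h0 hadd hcardV hS hoff0 hb hvals hT ha₀ ha₁ ha₂ ha₃ hPf t₀ t ht₀ ht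
    exact mem_image.2 ⟨bxor t₀ t, hr, bxor_bxor_cancel_left t₀ t⟩
  have hinj : Function.Injective (bxor t₀) := fun x y h => by
    have h' := congrArg (bxor t₀) h
    rwa [bxor_bxor_cancel_left, bxor_bxor_cancel_left] at h'
  have hcardim : #(R.image (bxor t₀)) = #R := card_image_of_injective _ hinj
  have hRle : 16 * #R ≤ #V₀ := d0_R_bound V₀ u'' xZ h0 hadd hS hb (d0_hsd f g hf hg u'' hu'' V₀ xZ h0 hadd hcardV hS hoff0 hb hvals) ha₀ ha₁ ha₂ ha₃ hPf
  rw [hcardV] at hRle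
  have h1 : 32 ≤ #R := by
    have h := card_le_card hsub
    rw [hcardim, hT] at h
    exact h
  have hReq : #R = 32 := by omega
  exact ⟨hReq, eq_of_subset_of_card_le hsub (by rw [hcardim, hReq, hT])⟩

end Summit.QuantumAdvantage.QuantumAdvantage.Theorems.CubicForrelation.NearExactIsExact

end
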